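import Summits.HodgeConjecture.HodgeConjecture.Theorems.F0P3XiUnramNonsplitInstance                       -- ★ generic `exists_spherical_constituent_of_isSpherical` (+ ★ `isSpherical_cmPrincipalSeries`, Iwasawa, admissibility)
import Summits.HodgeConjecture.HodgeConjecture.Theorems.R90S1PrincipalSeriesSphericalConstituentUnique     -- ★ S1 `principalSeries_sphericalConstituent_unique` (generic `U(σ, Φ_N)(R)`)
import HarnessLib

/-!
# R90 · S5 — DEAL #12 «U(Φ₂) SPHERICAL MEMBER»: the `U(Φ₂)(𝒪_v)`-spherical constituent of `i_{U(Φ₂)}((χ₁, χ₂))` for UNRAMIFIED `χ₁, χ₂`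
# EXISTS (admissible) and is UNIQUE — the `N = 2` twin of ★ `F0P3XiUnramNonsplitInstance.exists_spherical_constituent`

R90-TF SLAB (brief v2 1f40d54518340a35), section S5 (Ch. 13.3 multiplicity ∕ rigidity, base `R90-C133`), dealer R90-C133-plan (g0) DEAL #12
(R90 bus 2026-09-04T16:13:43Z, LEAD #21 spill); seat R90-C14-p02 (g0); census `R90/S5/R90-C14-p02/CENSUS-U2Spherical.md` 15329cd61deb905a.
Crux H413 = `stmt-HodgeConjecture-24833`, route `HCCMUnconditional`, lane `--supports … --as helper`.  ONE theorem; no definition, no instance,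
no notation, no `sorry`; imports ★ Theorems ∕ Literature only.  CONSUMERS: S7 («θ-ness is a property of the `DiscH`-token»: two realisations
agree off a finite set by the singleton unramified members at `N = 2`), S5's ★ `R90.S5.IsThetaMemberAt` readers (DEAL #11), S4's `U(Φ₂)`-packets,
S10's `H`-family.

THE STATEMENT.  `G₂ = U(Φ₂)(L⁺_v) = (cmDatum L 2 Φ₂).Local v` (the tree's `U2Loc`), `K₂ = U(Φ₂)(𝒪_v) =` ★ `cmLocalIntegralLevel L 2 Φ₂ v`, `χ₁` a character of
`(L ⊗ L⁺_v)ˣ`, `χ₂` a character of the norm-one units, both UNRAMIFIED (trivial on the units all of whose `w`-components have valuation `1` —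
★ p817292's spelling, as in the `N = 3` twin); `i(χ₁, χ₂) =` ★ `cmPrincipalSeries L 2 v (torusCharPair … 0 χ₁ χ₂)` (`χ(t) = χ₁(t₀₀)·χ₂(det t)`,
[Rogawski1990 §12.1 p. 171]).  THEN: there is a class `c ∈ Irr(G₂)` which is a CONSTITUENT of `i(χ₁, χ₂)`, ADMISSIBLE and `K₂`-SPHERICAL, and every
`K₂`-spherical constituent of `i(χ₁, χ₂)` equals it.  No parity hypothesis on `v` is used (none of the inputs needs it); consumers apply it at
non-split `v`.

THE PROOF (pure instantiation at `N = 2` of N-GENERIC ★ results).  `i(χ)` is admissible (★ `isAdmissible_cmPrincipalSeries_of_iwasawa` with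
Iwasawa `G₂ = B · K₂` ★ `exists_borel_mul_mem_cmLocalIntegralLevel`); `i(χ)^{K₂}` is a line (★ `isSpherical_cmPrincipalSeries`, «every N, every v»)
because `χ` is trivial on `T ∩ K₂`: there `v_w(t_ii) = 1` (★ `v_torusEntry_eq_one_of_mem_cmLocalIntegralLevel`), so `χ₁(t₀₀) = 1` and
`χ₂(det t) = χ₂(∏ t_ii) = 1`; the constituent through the spherical line (★ generic `exists_spherical_constituent_of_isSpherical`: Hecke eigenline
★ `IsSpherical.exists_isHeckeEigenAt` + ★ `Representation.exists_constituent_of_heckeEigenvector`) is admissible and `K₂`-spherical; uniqueness is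
S1's ★ `principalSeries_sphericalConstituent_unique` (generic `U(σ, Φ_N)(R)`, `f ↦ f(1)` injective on `i(χ)^K` + exactness of `V ↦ V^K`) at
`R = Π_{w∣v} L_w`, `N = 2` — CITED BY NAME, one term.

HONEST LABEL: HC_CM is proved only modulo the 7 printed citations (2 remaining named inputs: hLiu418 = stmt-HodgeConjecture-24832, h413 =
stmt-HodgeConjecture-24833) until rung 0 closes; this file proves a printed LOCAL statement ([Rogawski1990 §4.5 p. 45 «`i_G(χ)^K` is one-dimensional
by virtue of `G = BK`»; §11.1 p. 161; §12.1 p. 171] with [CartierCorvallis1979 §IV.1]) UNCONDITIONALLY and closes nothing global.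

## References
* [Rogawski1990] J. D. Rogawski, *Automorphic Representations of Unitary Groups in Three Variables*, Ann. of Math. Stud. 123 (1990): §4.5 p. 45;
  §11.1 p. 161; §12.1 p. 171; §12.2 pp. 173–174.
* [CartierCorvallis1979] P. Cartier, *Representations of p-adic groups: a survey*, Proc. Sympos. Pure Math. 33 (1979), part 1: §III.3, §IV.1 Thm. 4.1, Cor. 4.1.
* [Bump1997] D. Bump, *Automorphic Forms and Representations* (1997), §4.2 Prop. 4.2.3.
* [BernsteinZelevinsky1976] I. N. Bernstein, A. V. Zelevinsky, *Representations of the group GL(n, F) where F is a non-archimedean local field*,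
  Russian Math. Surveys 31 (1976), §2.3 Prop. 2.3, §2.25.
-/

set_option autoImplicit false
-- the mandated namespace repeats the single-problem summit's segment (`HodgeConjecture.HodgeConjecture`)
set_option linter.dupNamespace false

noncomputable section

namespace Summit.HodgeConjecture.HodgeConjecture.R90.S5

open MeasureTheory NumberField IsDedekindDomain
open Literature.NumberTheory.Automorphic Literature.NumberTheory.Automorphic.UnitaryGroup Literature.NumberTheory.Rogawski1990
open Summit.HodgeConjecture.HodgeConjecture.Cruxes.H413.F0P3XiUnramNonsplitInstance (exists_spherical_constituent_of_isSpherical)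
open Summit.HodgeConjecture.HodgeConjecture.R90.S1 (principalSeries_sphericalConstituent_unique)

variable (L : Type) [Field L] [NumberField L] [IsCMField L] (v : HeightOneSpectrum (𝓞 ↥(maximalRealSubfield L)))

/-! ## Private instantiations at `N = 2` (each N-GENERIC ★ input applied once; kept private — one public theorem per file) -/

/-- `i_{U(Φ₂)}(χ)` is admissible for every torus character `χ` (★ `isAdmissible_cmPrincipalSeries_of_iwasawa` + Iwasawa ★
`exists_borel_mul_mem_cmLocalIntegralLevel`, `N = 2`). [cite: Rogawski1990, §4.5 p. 45; §12.1 p. 171] [cite: BernsteinZelevinsky1976, §2.25] -/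
private theorem isAdmissible_cmPrincipalSeries_two
    (χ : ↥(torusU (conjLocal L (IsCMField.complexConj L) v) (cmLocalForm L 2 v)) →* ℂˣ) :
    (cmPrincipalSeries L 2 v χ).IsAdmissible :=
  isAdmissible_cmPrincipalSeries_of_iwasawa L 2 v (exists_borel_mul_mem_cmLocalIntegralLevel L 2 v) χ

/-- `i_{U(Φ₂)}((χ₁, χ₂))^{K₂}` is a line for unramified `χ₁, χ₂` (★ `isSpherical_cmPrincipalSeries`, `N = 2`: on `t ∈ T ∩ K₂` every `v_w(t_ii) = 1`
★ `v_torusEntry_eq_one_of_mem_cmLocalIntegralLevel`, so `χ₁(t₀₀) = 1` and `χ₂(det t) = χ₂(∏ t_ii) = 1`). [cite: Rogawski1990, §4.5 p. 45; §12.2 pp. 173–174] [cite: CartierCorvallis1979, §IV.1] -/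
private theorem isSpherical_cmPrincipalSeries_torusCharPair_two
    (χ₁ : (LocalRing L v)ˣ →* ℂˣ) (χ₂ : ↥(normOneUnits (conjLocal L (IsCMField.complexConj L) v)) →* ℂˣ)
    (hχ₁ : ∀ u : (LocalRing L v)ˣ, (∀ w : PlacesOver L v, Valued.v ((u : LocalRing L v) w) = 1) → χ₁ u = 1)
    (hχ₂ : ∀ u : ↥(normOneUnits (conjLocal L (IsCMField.complexConj L) v)),
      (∀ w : PlacesOver L v, Valued.v (((u : (LocalRing L v)ˣ) : LocalRing L v) w) = 1) → χ₂ u = 1) :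
    (cmPrincipalSeries L 2 v (torusCharPair (conjLocal L (IsCMField.complexConj L) v) (cmLocalForm L 2 v) (cmLocalForm_eq_over L 2 v) 0 χ₁ χ₂)).IsSpherical (cmLocalIntegralLevel L 2 (Matrix.of fun i j : Fin 2 => if i.val + j.val + 1 = 2 then (1 : L) else 0) v) := by
  refine isSpherical_cmPrincipalSeries L 2 v _ fun t ht => ?_
  have hent : ∀ (i : Fin 2) (w : PlacesOver L v),
      Valued.v (((torusEntry (conjLocal L (IsCMField.complexConj L) v) (cmLocalForm L 2 v) i t : (LocalRing L v)ˣ) :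
        LocalRing L v) w) = 1 := fun i w => v_torusEntry_eq_one_of_mem_cmLocalIntegralLevel L 2 v t ht i w
  -- the determinant argument of `χ₂`: `det t = ∏ t_ii`
  have hdet : ∀ w : PlacesOver L v,
      Valued.v (((torusDetNormOne (conjLocal L (IsCMField.complexConj L) v) (cmLocalForm L 2 v) (cmLocalForm_eq_over L 2 v) t :
        (LocalRing L v)ˣ) : LocalRing L v) w) = 1 := fun w => by
    obtain ⟨d, hd⟩ := (mem_torusU_iff _).1 t.2
    rw [coe_torusDetNormOne, torusDet_eq_of_glDiagonal_eq _ _ t d hd, Units.coe_prod, Finset.prod_apply, map_prod]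
    refine Finset.prod_eq_one fun i _ => ?_
    rw [← torusEntry_eq_of_glDiagonal_eq _ _ i t d hd]
    exact hent i w
  rw [torusCharPair_apply, hχ₁ _ (hent 0), hχ₂ _ hdet, one_mul]

/-- The constituent of `i_{U(Φ₂)}((χ₁, χ₂))` through the spherical line, with its Hecke eigen-scalars (★ generic
`exists_spherical_constituent_of_isSpherical`, `N = 2`; expected type spelled out as in the `N = 3` twin (N1)). [cite: Bump1997, §4.2 Prop. 4.2.3] [cite: CartierCorvallis1979, §IV.1 Cor. 4.1] -/
private theorem exists_spherical_constituent_two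
    (χ₁ : (LocalRing L v)ˣ →* ℂˣ) (χ₂ : ↥(normOneUnits (conjLocal L (IsCMField.complexConj L) v)) →* ℂˣ)
    (hχ₁ : ∀ u : (LocalRing L v)ˣ, (∀ w : PlacesOver L v, Valued.v ((u : LocalRing L v) w) = 1) → χ₁ u = 1)
    (hχ₂ : ∀ u : ↥(normOneUnits (conjLocal L (IsCMField.complexConj L) v)),
      (∀ w : PlacesOver L v, Valued.v (((u : (LocalRing L v)ˣ) : LocalRing L v) w) = 1) → χ₂ u = 1) :
    ∃ r : SmoothIrrep ((cmDatum L 2 (Matrix.of fun i j : Fin 2 => if i.val + j.val + 1 = 2 then (1 : L) else 0)).Local v),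
      (IrrClass.mk r).IsConstituentOf (cmPrincipalSeries L 2 v (torusCharPair (conjLocal L (IsCMField.complexConj L) v) (cmLocalForm L 2 v) (cmLocalForm_eq_over L 2 v) 0 χ₁ χ₂)) ∧ r.ρ.IsAdmissible ∧
        r.ρ.IsSpherical (cmLocalIntegralLevel L 2 (Matrix.of fun i j : Fin 2 => if i.val + j.val + 1 = 2 then (1 : L) else 0) v) ∧
          ∃ t : (cmDatum L 2 (Matrix.of fun i j : Fin 2 => if i.val + j.val + 1 = 2 then (1 : L) else 0)).Local v → ℂ,
            (cmPrincipalSeries L 2 v (torusCharPair (conjLocal L (IsCMField.complexConj L) v) (cmLocalForm L 2 v) (cmLocalForm_eq_over L 2 v) 0 χ₁ χ₂)).IsHeckeEigenAt (cmLocalIntegralLevel L 2 (Matrix.of fun i j : Fin 2 => if i.val + j.val + 1 = 2 then (1 : L) else 0) v) t ∧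
              r.ρ.IsHeckeEigenAt (cmLocalIntegralLevel L 2 (Matrix.of fun i j : Fin 2 => if i.val + j.val + 1 = 2 then (1 : L) else 0) v) t :=
  exists_spherical_constituent_of_isSpherical (isCompact_isOpen_cmLocalIntegralLevel L 2 (Matrix.of fun i j : Fin 2 => if i.val + j.val + 1 = 2 then (1 : L) else 0) v).2
    (isCompact_isOpen_cmLocalIntegralLevel L 2 (Matrix.of fun i j : Fin 2 => if i.val + j.val + 1 = 2 then (1 : L) else 0) v).1 _ (isAdmissible_cmPrincipalSeries_two L v _)
    (isSpherical_cmPrincipalSeries_torusCharPair_two L v χ₁ χ₂ hχ₁ hχ₂)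

/-- At most one `K₂`-spherical constituent (S1's ★ generic `principalSeries_sphericalConstituent_unique` at `R = Π_{w ∣ v} L_w`, `N = 2`, first
conjunct; CITED BY NAME). [cite: Rogawski1990, §4.5 p. 45] [cite: CartierCorvallis1979, §III.3, §IV.1 Thm. 4.1] [cite: BernsteinZelevinsky1976, §2.3 Prop. 2.3] -/
private theorem sphericalConstituent_unique_two
    (χ : ↥(torusU (conjLocal L (IsCMField.complexConj L) v) (cmLocalForm L 2 v)) →* ℂˣ) :
    ∀ c c' : IrrClass ((cmDatum L 2 (Matrix.of fun i j : Fin 2 => if i.val + j.val + 1 = 2 then (1 : L) else 0)).Local v),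
      c.IsConstituentOf (cmPrincipalSeries L 2 v χ) → c'.IsConstituentOf (cmPrincipalSeries L 2 v χ) →
      c.IsSpherical (cmLocalIntegralLevel L 2 (Matrix.of fun i j : Fin 2 => if i.val + j.val + 1 = 2 then (1 : L) else 0) v) → c'.IsSpherical (cmLocalIntegralLevel L 2 (Matrix.of fun i j : Fin 2 => if i.val + j.val + 1 = 2 then (1 : L) else 0) v) → c = c' := by
  haveI := locallyCompactSpace_cmBorelU L 2 v
  exact (principalSeries_sphericalConstituent_unique (conjLocal L (IsCMField.complexConj L) v) (cmLocalForm L 2 v)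
    (cmLocalForm_eq_over L 2 v) (isCompact_isOpen_cmLocalIntegralLevel L 2 (Matrix.of fun i j : Fin 2 => if i.val + j.val + 1 = 2 then (1 : L) else 0) v).1
    (exists_borel_mul_mem_cmLocalIntegralLevel L 2 v) χ).1

/-! ## The theorem -/

/-- **The `U(Φ₂)(𝒪_v)`-spherical constituent of `i_{U(Φ₂)}((χ₁, χ₂))` for unramified `χ₁, χ₂`: EXISTS (admissible) and is UNIQUE** — the `N = 2` twin of
★ `F0P3XiUnramNonsplitInstance.exists_spherical_constituent` joined with S1's ★ `principalSeries_sphericalConstituent_unique`.  For `χ₁ : (L ⊗ L⁺_v)ˣ → ℂˣ`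
and `χ₂ : (norm-one units) → ℂˣ` both trivial on the units of valuation one at every `w ∣ v`, there is `c ∈ Irr(U(Φ₂)(L⁺_v))`, a constituent of
★ `cmPrincipalSeries L 2 v (torusCharPair … 0 χ₁ χ₂)`, admissible and `K₂`-spherical (`K₂ =` ★ `cmLocalIntegralLevel L 2 Φ₂ v`), and every `K₂`-spherical
constituent equals `c`. [cite: Rogawski1990, §4.5 p. 45; §11.1 p. 161; §12.1 p. 171] [cite: CartierCorvallis1979, §IV.1 Thm. 4.1, Cor. 4.1] [cite: Bump1997, §4.2 Prop. 4.2.3] -/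
theorem existsUnique_spherical_constituent_two
    (χ₁ : (LocalRing L v)ˣ →* ℂˣ) (χ₂ : ↥(normOneUnits (conjLocal L (IsCMField.complexConj L) v)) →* ℂˣ)
    (hχ₁ : ∀ u : (LocalRing L v)ˣ, (∀ w : PlacesOver L v, Valued.v ((u : LocalRing L v) w) = 1) → χ₁ u = 1)
    (hχ₂ : ∀ u : ↥(normOneUnits (conjLocal L (IsCMField.complexConj L) v)),
      (∀ w : PlacesOver L v, Valued.v (((u : (LocalRing L v)ˣ) : LocalRing L v) w) = 1) → χ₂ u = 1) :
    ∃ c : IrrClass ((cmDatum L 2 (Matrix.of fun i j : Fin 2 => if i.val + j.val + 1 = 2 then (1 : L) else 0)).Local v),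
      (c.IsConstituentOf
          (cmPrincipalSeries L 2 v
            (torusCharPair (conjLocal L (IsCMField.complexConj L) v) (cmLocalForm L 2 v) (cmLocalForm_eq_over L 2 v) 0 χ₁ χ₂)) ∧
        c.IsAdmissible ∧
        c.IsSpherical (cmLocalIntegralLevel L 2 (Matrix.of fun i j : Fin 2 => if i.val + j.val + 1 = 2 then (1 : L) else 0) v)) ∧
      ∀ c' : IrrClass ((cmDatum L 2 (Matrix.of fun i j : Fin 2 => if i.val + j.val + 1 = 2 then (1 : L) else 0)).Local v),
        c'.IsConstituentOf
            (cmPrincipalSeries L 2 v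
              (torusCharPair (conjLocal L (IsCMField.complexConj L) v) (cmLocalForm L 2 v) (cmLocalForm_eq_over L 2 v) 0 χ₁ χ₂)) →
          c'.IsSpherical (cmLocalIntegralLevel L 2 (Matrix.of fun i j : Fin 2 => if i.val + j.val + 1 = 2 then (1 : L) else 0) v) →
          c' = c := by
  obtain ⟨r, hc, hradm, hr1, -⟩ := exists_spherical_constituent_two L v χ₁ χ₂ hχ₁ hχ₂
  refine ⟨IrrClass.mk r, ⟨hc, (IrrClass.isAdmissible_mk r).2 hradm, (IrrClass.isSpherical_mk r _).2 hr1⟩, fun c' hc' h1' => ?_⟩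
  exact sphericalConstituent_unique_two L v _ c' (IrrClass.mk r) hc' hc h1' ((IrrClass.isSpherical_mk r _).2 hr1)

end Summit.HodgeConjecture.HodgeConjecture.R90.S5

end
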